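import Summits.BirchSwinnertonDyer.BirchSwinnertonDyer.Theorems.SchneiderFreeAdditiveX3GoodMember
import Literature.NumberTheory.EllipticCurves.ModularParametrizationBCDTProofs
import Literature.NumberTheory.EllipticCurves.CuspFormLFunctionLevelConductorProofs
import Literature.NumberTheory.EllipticCurves.ModularCurveManinSemistableBridgeProofs
import HarnessLib

/-!
# Route `SchneiderFreeAdditiveX3` (K1 door), crux `GordTwoBranchIMC` (stmt-BirchSwinnertonDyer-19177),
# line «KY-read» (skeleton v5, P2 g13): the registered stub `stub_goodMember`, DISCHARGED modulo the
# route's own modularity input (`PrintedFacts` conjunct 5, `nonempty_modularParametrizationData`)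

Cell `bsd-schneider-ideate` (HOME `run/shared/lean/pub/bsd-schneider-ideate/`), seat `door-c4` gen 7
(file 5; files 1–3 `SchneiderFreeAdditiveX3GoodMember{Nonsplit,Line,}.lean`). PARTITION: board row
B6 ∩ X3 ∩ sst-twist, r = 1, (G-ord, `e = 2`) cell (2 560 pairs); types-the-object-of the registered stub
`stub_goodMember` of skeleton v5 «KY-read» on crux r3 (sha bcbd83ef): it is a THEOREM modulo ONE
conjunct the composition `GordTwoBranchIMC_of_stubs (hF : PrintedFacts) …` already destructures
(`hPar : nonempty_modularParametrizationData`); closes nothing by name (the registered stub is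
fact-free; its clause `N_{W₁} = N_W` is the `ℚ`-isogeny invariance of the conductor, in the tree only
via Ogg–Saito or via modularity — see below); BSD is not advanced. THEOREMS ONLY.

* `conductorNorm_eq_of_isIsogenous_of_modularParametrization` — **`N_{W₁} = N_W` for `ℚ`-isogenous
  elliptic curves, from modularity**: `nonempty_modularParametrizationData` ⟹ `exists_isNewformOf`
  (tree, BCDT (6) ⇒ (2)); the newform `f ∈ S₂(Γ₀(N_W))` of `W` is a newform of `W₁` (tree
  `IsNewformOf.of_isIsogenous`, same `L`-series), so `N_W = N_{W₁}` by the tree's multiplicity-one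
  level theorem `IsNewformOf.level_eq_conductorNorm_of_exists_isNewformOf`. (Second road to the
  conductor clause, beside file 3's Ogg–Saito road `conductorNorm_eq_of_isIsogenous_of_tate`.)
* `exists_goodMember_of_conductorEq` — file 3's `exists_goodMember` with the conductor input
  abstracted to a hypothesis `N_{W'} = N_W` for the curves `W'` isogenous to `W`;
  `exists_goodMember_of_modularParametrization` — fed by modularity.
* **`stub_goodMember_of_modularParametrization : nonempty_modularParametrizationData → ‹stub_goodMember›`**
  and `stub_goodMember_of_oggSaito : (Ogg–Saito schema) → ‹stub_goodMember›`, the registered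
  signature VERBATIM after the arrow (the stub's split-prime hypothesis
  `#primesOver (p) 𝓞_K = 2` gives `p ∤ d_K` by `SatisfiesHeegnerHypothesis.not_dvd_discr`).
  @P2: re-register `stub_goodMember` with the prefix `nonempty_modularParametrizationData →` (the
  composition passes `hPar`, conjunct 5 of `PrintedFacts`) and it closes by
  `stub_goodMember_of_modularParametrization`; as registered (fact-free) it asserts the isogeny
  invariance of the conductor, which the tree proves only from Ogg–Saito / modularity.

References: T. Keller, M. Yin, arXiv:2410.23241 §3.1, §3.3 ¶1, Rem. 3.5.2 [KellerYin2024PotOrd];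
Breuil–Conrad–Diamond–Taylor, JAMS 14 (2001) Thm. A; Diamond–Shurman, GTM 228, Thm. 8.8.1/8.8.3
[DiamondShurman2005]; A. W. Knapp, *Elliptic Curves* (1993) Thm. 11.67; HOME/memos/FINDING-door-c4-g7.md.
-/

set_option linter.dupNamespace false
set_option autoImplicit false

noncomputable section

open scoped Classical NumberField

open WeierstrassCurve NumberField IsDedekindDomain Literature.NumberTheory.EllipticCurves
  Literature.NumberTheory.EllipticCurves.Rank1Residual
  Literature.NumberTheory.EllipticCurves.ModularForms
  Literature.NumberTheory.GaloisRepresentations Field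
  Literature.NumberTheory.EllipticCurves.KellerYin2024
  Summit.BirchSwinnertonDyer.Rank1Residual.X1.StableCyclicQuotient
  Summit.BirchSwinnertonDyer.Rank1Residual
  Summit.BirchSwinnertonDyer.Rank1Residual.Additive

namespace Summit.BirchSwinnertonDyer.BirchSwinnertonDyer.Theorems.SchneiderFree.GoodMember

variable {p : ℕ} [hp : Fact p.Prime]

omit hp in
/-- **The conductor is a `ℚ`-isogeny invariant, granted modularity.** From
`nonempty_modularParametrizationData` (every globally minimal elliptic `E/ℚ` has a modular
parametrisation datum; Breuil–Conrad–Diamond–Taylor) the tree derives `exists_isNewformOf`; the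
newform of `W` at level `N_W` is a newform of any `W₁` isogenous to `W` over `ℚ` (same `L`-series,
`IsNewformOf.of_isIsogenous`), and a newform of `W₁` has level `N_{W₁}` (multiplicity one across
levels, `IsNewformOf.level_eq_conductorNorm_of_exists_isNewformOf`).
[cite: DiamondShurman2005, Thm. 8.8.1 and Thm. 8.8.3] [cite: Knapp1993, Thm. 11.67 (PDF p. 281)] -/
theorem conductorNorm_eq_of_isIsogenous_of_modularParametrization
    (hPar : nonempty_modularParametrizationData) (W W₁ : WeierstrassCurve ℚ) [W.IsElliptic]
    [W₁.IsElliptic] (hiso : IsIsogenous W₁ W) : W₁.conductorNorm ℤ = W.conductorNorm ℤ := by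
  have h₁ := exists_isNewformOf_of_nonempty_modularParametrizationData hPar
  haveI : NeZero (W.conductorNorm ℤ) := ⟨(WeierstrassCurve.conductorNorm_pos_holds W).ne'⟩
  obtain ⟨f, hf⟩ := h₁ W
  exact (IsNewformOf.level_eq_conductorNorm_of_exists_isNewformOf h₁ (hf.of_isIsogenous hiso)).symm

/-- **K-W with the conductor input abstracted.** As file 3's `exists_goodMember`, the clause
`N_{W₁} = N_W` being supplied by a hypothesis `hN` (conductor invariance for the curves
`ℚ`-isogenous to `W`), so that either road — Ogg–Saito (`conductorNorm_eq_of_isIsogenous_of_tate`)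
or modularity (`conductorNorm_eq_of_isIsogenous_of_modularParametrization`) — can feed it.
[cite: KellerYin2024PotOrd, §3.1 (Case (I); φ|G_p ≠ 1; E(K)[p] = 0), arXiv:2410.23241 pp. 13–17]
[cite: SilvermanAEC2009, Thm. III.6.1(a), Prop. III.4.12, Cor. IX.6.2, X.5 Cor. 5.4] -/
theorem exists_goodMember_of_conductorEq (hp2 : p ≠ 2) (W : WeierstrassCurve ℚ) [W.IsElliptic]
    [W.IsGloballyMinimal]
    (hN : ∀ (W₁ : WeierstrassCurve ℚ) [W₁.IsElliptic], IsIsogenous W₁ W →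
      W₁.conductorNorm ℤ = W.conductorNorm ℤ)
    (hX : ClassX3 W p) (hS : SubGordTwo W p)
    (K : Type) [Field K] [NumberField K] (h2K : Module.finrank ℚ K = 2)
    (hpd : ¬ (p : ℤ) ∣ NumberField.discr K) :
    ∃ (W₁ : WeierstrassCurve ℚ) (_ : W₁.IsElliptic) (_ : W₁.IsGloballyMinimal) (φ : Isogeny W₁ W) (m : ℕ),
      φ.degree = p ^ m * 1 ∧ ¬ p ∣ 1 ∧ W₁.conductorNorm ℤ = W.conductorNorm ℤ ∧
      W₁.HasGoodOrdinaryReductionOverQuadraticAt p ∧ Red W₁ p ∧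
      (∃ Φ : AddSubgroup (geomTorsion W₁ (p : ℤ)),
        IsRationalLine W₁ p Φ ∧ ¬ LineDecompositionTrivialAt W₁ p Φ) ∧
      ∀ Q : (W₁.baseChange K).toAffine.Point, p • Q = 0 → Q = 0 := by
  have hp' : p.Prime := hp.out
  obtain ⟨Φ₀, hΦ₀⟩ := exists_isRationalLine_of_not_irr (W := W) (p := p) hX.1
  obtain ⟨W₁, hW₁, hW₁min, g, k, L, hdeg, hL, huniq, hn1, hn2, hn3⟩ :=
    exists_member_uniqueLine (V := W) hp2 hΦ₀ hpd
  haveI := hW₁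
  haveI := hW₁min
  -- the dual isogeny `φ : W₁ → W`, `φ ∘ g = [p^k]`, has degree `p^k`
  obtain ⟨φ, hφ⟩ := g.exists_dual_of_isElliptic
  have hφdeg : φ.degree = p ^ k := by
    have h1 : Nat.card (φ.comp g).toAddMonoidHom.ker = Nat.card φ.toAddMonoidHom.ker * g.degree :=
      AddMonoidHom.natCard_ker_comp_of_surjective φ.toAddMonoidHom g.toAddMonoidHom g.surjective
    have hker : (φ.comp g).toAddMonoidHom.ker = geomTorsion W ((p ^ k : ℕ) : ℤ) := by
      ext P
      rw [AddMonoidHom.mem_ker, Isogeny.coe_toAddMonoidHom, Isogeny.comp_apply, hφ, hdeg]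
      exact (Submodule.mem_torsionBy_iff _ _).symm
    have hpk : ((p ^ k : ℕ) : ℚ) ≠ 0 := by exact_mod_cast pow_ne_zero k hp'.ne_zero
    rw [hker, natCard_geomTorsion_eq_sq W hpk, hdeg, sq] at h1
    unfold Isogeny.degree
    exact (Nat.eq_of_mul_eq_mul_right (pow_pos hp'.pos k) h1).symm
  have hiso : IsIsogenous W W₁ := ⟨g⟩
  have hiso' : IsIsogenous W₁ W := ⟨φ⟩
  -- the cell predicates for `W₁`
  have hG : TypeG W p := (subGord_iff_typeG_of_addv W p hp2 hX.2).mp hS.1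
  have hadd₁ : Addv W₁ p := Addv.of_isIsogenous_of_typeG hX.2 hG hiso
  have hSG₁ : SubGord W₁ p := (subGord_iff_of_isIsogenous hp2 hX.2 hiso).mp hS.1
  have he₁ : semistabilityIndex W₁ p = 2 :=
    (semistabilityIndex_eq_of_isIsogenous_of_typeG_of_addv hp2 hX.2 hG hiso).trans hS.2
  have hred₁ : Red W₁ p := red_of_isRationalLine hL
  have hcase₁ : W₁.HasGoodOrdinaryReductionOverQuadraticAt p :=
    hasGoodOrdinaryReductionOverQuadraticAt_of_subGordTwo hp2 W₁ ⟨hred₁, hadd₁⟩ ⟨hSG₁, he₁⟩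
  exact ⟨W₁, hW₁, hW₁min, φ, k, by rw [hφdeg, mul_one], hp'.not_dvd_one, hN W₁ hiso', hcase₁, hred₁,
    ⟨L, hL, hn3⟩, fun Q hQ ↦ forall_baseChange_nsmul_eq_zero hp2 huniq hn1 h2K hpd hn2 Q hQ⟩

/-- **K-W granted modularity** (`nonempty_modularParametrizationData`, conjunct 5 of the route's
`PrintedFacts`): the good member with `N_{W₁} = N_W` by
`conductorNorm_eq_of_isIsogenous_of_modularParametrization`.
[cite: KellerYin2024PotOrd, §3.1, arXiv:2410.23241 pp. 13–17] [cite: DiamondShurman2005, Thm. 8.8.1] -/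
theorem exists_goodMember_of_modularParametrization (hPar : nonempty_modularParametrizationData)
    (hp2 : p ≠ 2) (W : WeierstrassCurve ℚ) [W.IsElliptic] [W.IsGloballyMinimal]
    (hX : ClassX3 W p) (hS : SubGordTwo W p)
    (K : Type) [Field K] [NumberField K] (h2K : Module.finrank ℚ K = 2)
    (hpd : ¬ (p : ℤ) ∣ NumberField.discr K) :
    ∃ (W₁ : WeierstrassCurve ℚ) (_ : W₁.IsElliptic) (_ : W₁.IsGloballyMinimal) (φ : Isogeny W₁ W) (m : ℕ),
      φ.degree = p ^ m * 1 ∧ ¬ p ∣ 1 ∧ W₁.conductorNorm ℤ = W.conductorNorm ℤ ∧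
      W₁.HasGoodOrdinaryReductionOverQuadraticAt p ∧ Red W₁ p ∧
      (∃ Φ : AddSubgroup (geomTorsion W₁ (p : ℤ)),
        IsRationalLine W₁ p Φ ∧ ¬ LineDecompositionTrivialAt W₁ p Φ) ∧
      ∀ Q : (W₁.baseChange K).toAffine.Point, p • Q = 0 → Q = 0 :=
  exists_goodMember_of_conductorEq hp2 W
    (fun W₁ _ h ↦ conductorNorm_eq_of_isIsogenous_of_modularParametrization hPar W W₁ h) hX hS K h2K hpd

omit hp in
/-- The stub's split-prime hypothesis `#{𝔭 ∣ p} = 2` gives `p ∤ d_K` (split primes are unramified;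
tree `SatisfiesHeegnerHypothesis.not_dvd_discr` at level `p`). [folklore] -/
theorem not_dvd_discr_of_ncard_primesOver_eq_two {p : ℕ} (hp : p.Prime) {K : Type} [Field K]
    [NumberField K] (h2K : Module.finrank ℚ K = 2)
    (hsplit : ((Ideal.span {(p : ℤ)}).primesOver (𝓞 K)).ncard = 2) :
    ¬ (p : ℤ) ∣ NumberField.discr K := by
  have hHe : SatisfiesHeegnerHypothesis p K := fun q hq hqp ↦ by
    obtain rfl : q = p := (Nat.prime_dvd_prime_iff_eq hq hp).mp hqp
    exact hsplit
  exact Literature.SatisfiesHeegnerHypothesis.not_dvd_discr h2K hHe hp (dvd_refl p)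

/-- **The registered stub `stub_goodMember` of skeleton v5 «KY-read» (crux r3, 19177), GRANTED
MODULARITY** — its signature verbatim after `nonempty_modularParametrizationData →` (conjunct 5 of
`PrintedFacts`, the `hPar` the composition `GordTwoBranchIMC_of_stubs` already destructures).
[cite: KellerYin2024PotOrd, §3.3 ¶1 and Rem. 3.5.2 (arXiv:2410.23241 pp. 14, 20)]
[cite: DiamondShurman2005, Thm. 8.8.1 and Thm. 8.8.3] -/
theorem stub_goodMember_of_modularParametrization (hPar : nonempty_modularParametrizationData) :
    ∀ (W : WeierstrassCurve ℚ) [W.IsElliptic] [W.IsGloballyMinimal] (p : ℕ) [Fact p.Prime],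
        p ≠ 2 → ClassX3 W p → Additive.SubGordTwo W p →
        ∀ (K : Type) [Field K] [NumberField K], IsImaginaryQuadratic K →
        ((Ideal.span {(p : ℤ)}).primesOver (𝓞 K)).ncard = 2 →
        ∃ (W₁ : WeierstrassCurve ℚ) (_ : W₁.IsElliptic) (_ : W₁.IsGloballyMinimal)
          (φ : WeierstrassCurve.Isogeny W₁ W) (m d : ℕ),
          φ.degree = p ^ m * d ∧ ¬ p ∣ d ∧ W₁.conductorNorm ℤ = W.conductorNorm ℤ ∧
          W₁.HasGoodOrdinaryReductionOverQuadraticAt p ∧ Red W₁ p ∧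
          (∃ Φ : AddSubgroup (geomTorsion W₁ (p : ℤ)),
            IsRationalLine W₁ p Φ ∧ ¬ LineDecompositionTrivialAt W₁ p Φ) ∧
          ∀ Q : (W₁.baseChange K).toAffine.Point, p • Q = 0 → Q = 0 := by
  intro W _ _ p _ hp2 hX hS K _ _ hK hsplit
  obtain ⟨W₁, h₁, h₂, φ, m, h⟩ := exists_goodMember_of_modularParametrization hPar hp2 W hX hS K hK.1
    (not_dvd_discr_of_ncard_primesOver_eq_two Fact.out hK.1 hsplit)
  exact ⟨W₁, h₁, h₂, φ, m, 1, h⟩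

/-- **The registered stub `stub_goodMember`, GRANTED THE OGG–SAITO SCHEMA** (file 3's road):
signature verbatim after the arrow.
[cite: KellerYin2024PotOrd, §3.3 ¶1 and Rem. 3.5.2 (arXiv:2410.23241 pp. 14, 20)]
[cite: SilvermanATAEC1994, Exercise 4.40 (PDF p. 380) with Thm. IV.10.2 and IV.11.1] -/
theorem stub_goodMember_of_oggSaito
    (hOS : ∀ (V : WeierstrassCurve ℚ) (ℓ : ℕ) [Fact ℓ.Prime],
      V.artinConductorExponent_tate_eq_conductorExponent_of_isElliptic ℓ) :
    ∀ (W : WeierstrassCurve ℚ) [W.IsElliptic] [W.IsGloballyMinimal] (p : ℕ) [Fact p.Prime],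
        p ≠ 2 → ClassX3 W p → Additive.SubGordTwo W p →
        ∀ (K : Type) [Field K] [NumberField K], IsImaginaryQuadratic K →
        ((Ideal.span {(p : ℤ)}).primesOver (𝓞 K)).ncard = 2 →
        ∃ (W₁ : WeierstrassCurve ℚ) (_ : W₁.IsElliptic) (_ : W₁.IsGloballyMinimal)
          (φ : WeierstrassCurve.Isogeny W₁ W) (m d : ℕ),
          φ.degree = p ^ m * d ∧ ¬ p ∣ d ∧ W₁.conductorNorm ℤ = W.conductorNorm ℤ ∧
          W₁.HasGoodOrdinaryReductionOverQuadraticAt p ∧ Red W₁ p ∧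
          (∃ Φ : AddSubgroup (geomTorsion W₁ (p : ℤ)),
            IsRationalLine W₁ p Φ ∧ ¬ LineDecompositionTrivialAt W₁ p Φ) ∧
          ∀ Q : (W₁.baseChange K).toAffine.Point, p • Q = 0 → Q = 0 := by
  intro W _ _ p _ hp2 hX hS K _ _ hK hsplit
  obtain ⟨W₁, h₁, h₂, φ, m, h⟩ := exists_goodMember hOS hp2 W hX hS K hK.1
    (not_dvd_discr_of_ncard_primesOver_eq_two Fact.out hK.1 hsplit)
  exact ⟨W₁, h₁, h₂, φ, m, 1, h⟩

end Summit.BirchSwinnertonDyer.BirchSwinnertonDyer.Theorems.SchneiderFree.GoodMember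

end
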